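import Summits.BirchSwinnertonDyer.BirchSwinnertonDyer.Theorems.ThetaPartnerAtTwoSignedMainConjectureCMTwoRankZeroLevelModEight
import Summits.BirchSwinnertonDyer.BirchSwinnertonDyer.Theorems.ThetaPartnerAtTwoSignedMainConjectureCMTwoRankZeroFlatOfCuspSpan
import HarnessLib

/-!
# Route `ThetaPartnerAtTwo`, crux K2r0P `SignedMainConjectureCMTwoRankZeroOfPub` (stmt-BirchSwinnertonDyer-24945),
# line `rankzero` v14, stub (μ♭)_A: the LEVEL-16 CERTIFICATE — at conductors `N ≡ ±1 (mod 8)` the stub (μ♭)_A HOLDS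
# for every rank-`0` CM curve with `2 ∥ #Ш(A)·∏c_ℓ(A)`, granted only the printed inputs of the crux

Cell `bsd-wall`, width seat `bsd-wall-tp2-p2-w3` (g2) on the lead line `rankzero` (skeleton v14 68851f95fafc3a88, stubs
(LD±2^k)_A, (μ♭)_A). THEOREMS ONLY (no `def`, no named fact, no `sorry`); helper `--supports` the crux; nothing about any
particular curve is asserted; BSD is not proved by any of this.

The predecessor seat (w3 g0, `…RankZeroLevelModEight`, p609853) proved from the Fricke symmetry at denominator `16` and Hecke
at `2` that for a rational newform `f` of odd level `N ≡ ±1 (mod 8)` with `a₂ = 0` and Fricke sign `+1`,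
`[0]⁺_f = 4·[b/16]⁺_f` (`b ∈ {1, 3}`), and read it NEGATIVELY (the unit zone is empty there). This file reads the SAME
identity POSITIVELY: the `2`-adic valuation of the level-`16` plus symbol `[b/16]⁺_f` is `ord₂ [0]⁺_f − 2`, so

* §1 `norm_ratPlusSymbol_sixteenth_eq_two_of_padicValRat_eq_one` — if `ord₂ (L(f,1)/Ω⁺_f) = 1` then `|[b/16]⁺_f|₂ = 2`,
  a genuine `2`-adic half-integer at layer `n = 2`, hence (`SignedMuAtTwo.flatAtTwo_of_two_le_norm_ratPlusSymbol`, the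
  FlatSymbols door of the RTT seats, relocated to the cusp `5^s/2^4` by `exists_ratPlusSymbol_pow_cyclotomicGenerator_eq`)
  `flatAtTwo_of_mod_eight_of_padicValRat_eq_one`: **`2 ∤ L♭` for every Pollack pair of `f` at `2`** (μ(L♭_f) = 0) —
  a LEVEL-16 FLAT CERTIFICATE decided by the `2`-adic valuation of the central `L`-value alone;
* §2 `padicValRat_ratPlusSymbol_zero_eq_of_pub` — the zone bookkeeping of the lineage (`…RankZeroOfLocal` §4,
  `unitZone_of_not_two_dvd_shaOrder_mul_tamagawaProduct`) in full: granted Burungale–Flach (`hBF`), the entire continuation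
  (`hLrat`), GZK (`hGZK`) and the `p = 2` period fact (`h2`), for a CM curve `A` of analytic rank `0`, good supersingular at
  `2`: **`ord₂ [0]⁺_{f_A} = ord₂ #Ш(A) + ord₂ ∏c_ℓ(A)`** for the newform `f_A`;
* §3 `analyticMuFlat_at_of_mod_eight_of_padicValNat_eq_one` — hence, with modularity (`hmod`) to name the newform:
  **(μ♭)_A AT every CM `A/ℚ` of analytic rank `0`, good supersingular at `2` with `a₂ = 0`, `N_A ≡ ±1 (mod 8)` and
  `ord₂ (#Ш(A)·∏c_ℓ(A)) = 1`** — the registered stub's conclusion `∃ n, IsUnit (coeff n (kobayashiL 1 L⁺ L⁻))` for every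
  newform and Pollack pair, from PUBLISHED inputs only (no (G′)_N, no multiplicity one, no census datum). In the seat's
  census (`FLAT-CENSUS-CM-RANK0-v1.md`) these are exactly the off-zone classes certified «at level 16 with N ≡ 1 (mod 8)»
  (225b, 441a, 1089a/b/e, 7569b, 11025c/d/j, 15129b, 16641b, 17689d, 19881a/b, 27225c/e/ba, 43681h, 64009a, …).

References: B. Mazur, J. Tate, J. Teitelbaum, Invent. Math. 84 (1986) §I.4 (4.2), §I.8, §I.17 [MazurTateTeitelbaum1986Invent];
A. O. L. Atkin, J. Lehner, Math. Ann. 185 (1970) Thm. 3 [AtkinLehner1970]; R. Pollack, Duke Math. J. 118 (2003) Prop. 6.18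
[Pollack2003]; A. Burungale, M. Flach, Camb. J. Math. (2024) Thm. 1.1 [BurungaleFlach2024].
-/

set_option autoImplicit false
-- the Theorems namespace of this sub repeats the summit name by design (D-0017 nested layout)
set_option linter.dupNamespace false

noncomputable section

open scoped Classical NumberField MatrixGroups ModularForm

open NumberField IsDedekindDomain CongruenceSubgroup

namespace Summit.BirchSwinnertonDyer.BirchSwinnertonDyer.Theorems

open Literature.NumberTheory.EllipticCurves Literature.NumberTheory.GaloisRepresentations
  WeierstrassCurve Literature.NumberTheory.EllipticCurves.ModularForms Literature.NumberTheory.EllipticCurves.Rank1Residual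
  Literature.NumberTheory.EllipticCurves.Rank1Residual.Typed
  Summit.BirchSwinnertonDyer.Rank1Residual Summit.BirchSwinnertonDyer.Rank1Residual.Supersingular

namespace FlatLevelSixteen

/-! ## §1. `ord₂ [0]⁺_f = 1` at `N ≡ ±1 (mod 8)`: the level-`16` plus symbol is a `2`-adic half-integer, hence FLAT -/

section Symbols

variable {N : ℕ} [NeZero N] {f : CuspForm (Gamma0 N) 2}

/-- `|q|₂ = 2^{-ord₂ q}` for a non-zero rational read in `ℚ₂`. [folklore] -/
theorem norm_ratCast_eq_two_zpow_neg_padicValRat {q : ℚ} (hq : q ≠ 0) :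
    ‖((q : ℚ) : ℚ_[2])‖ = (2 : ℝ) ^ (-padicValRat 2 q) := by
  have hq0 : ((q : ℚ) : ℚ_[2]) ≠ 0 := by exact_mod_cast hq
  rw [Padic.norm_eq_zpow_neg_valuation hq0, Padic.valuation_ratCast]
  norm_num

/-- **`|[b/16]⁺_f|₂ = 2` when `ord₂ [0]⁺_f = 1`, `N ≡ ±1 (mod 8)`, Fricke sign `+1`, `a₂ = 0`**: the predecessor's identity
`[0]⁺_f = 4·[b/16]⁺_f` (`LevelModEight.exists_ratPlusSymbol_zero_eq_four_mul`) read positively.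
[cite: MazurTateTeitelbaum1986Invent, §I.4 (4.2), §I.8 and §I.17] [cite: AtkinLehner1970, Thm. 3] -/
theorem norm_ratPlusSymbol_sixteenth_eq_two_of_padicValRat_eq_one (hf : IsNewform0 f) (hQ : coeffField f = ⊥)
    (h2N : ¬ 2 ∣ N) (ha₂ : cuspCoeff f 2 = ((0 : ℤ) : ℂ)) (hW : IsFrickeEigen N f (-((1 : ℤ) : ℂ)))
    (hN : N % 8 = 1 ∨ N % 8 = 7) (hv : padicValRat 2 (ratPlusSymbol f 0) = 1) :
    ∃ b : ℤ, (b = 3 ∨ b = 1) ∧ ‖((ratPlusSymbol f ((b : ℚ) / 16) : ℚ) : ℚ_[2])‖ = 2 := by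
  obtain ⟨b, hb, h0⟩ := LevelModEight.exists_ratPlusSymbol_zero_eq_four_mul hf hQ h2N ha₂ hW hN
  refine ⟨b, hb, ?_⟩
  have hs0 : ratPlusSymbol f 0 ≠ 0 := by
    intro h
    rw [h, padicValRat.zero] at hv
    exact zero_ne_one hv
  have hx0 : ratPlusSymbol f ((b : ℚ) / 16) ≠ 0 := by
    intro h
    rw [h, mul_zero] at h0
    exact hs0 h0
  have hx : ratPlusSymbol f ((b : ℚ) / 16) = ratPlusSymbol f 0 / 4 := by rw [h0]; ring
  have h22 : padicValRat 2 (2 : ℚ) = 1 := by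
    have h := padicValRat.self (p := 2) one_lt_two
    simpa using h
  have h4 : padicValRat 2 (4 : ℚ) = 2 := by
    rw [show (4 : ℚ) = (2 : ℚ) ^ (2 : ℕ) by norm_num, padicValRat.pow (p := 2) (2 : ℚ), h22]
    norm_num
  have hval : padicValRat 2 (ratPlusSymbol f ((b : ℚ) / 16)) = -1 := by
    rw [hx, padicValRat.div hs0 (by norm_num), hv, h4]
    norm_num
  rw [norm_ratCast_eq_two_zpow_neg_padicValRat hx0, hval]
  norm_num

/-- **LEVEL-16 FLAT CERTIFICATE.** For a normalised newform `f` of odd level `N ≡ ±1 (mod 8)` with rational coefficients,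
`a₂(f) = 0`, Fricke sign `+1` (`f|w_N = −f`) and `ord₂ (L(f,1)/Ω⁺_f) = 1`: `2 ∤ L♭` for EVERY Pollack pair `(L♯, L♭)` of `f`
at `2` (μ(L♭_f) = 0) — the half-integral layer-`2` symbol `[b/16]⁺_f` relocated to `5^s/2^4` (`±5^s` covers the odd residues
mod `16`) and fed to the FlatSymbols door. [cite: Pollack2003, Prop. 6.18] [cite: MazurTateTeitelbaum1986Invent, §I.8, §I.13 and §I.17] -/
theorem flatAtTwo_of_mod_eight_of_padicValRat_eq_one (hf : IsNewform0 f) (hQ : coeffField f = ⊥) (h2N : ¬ 2 ∣ N)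
    (ha₂ : cuspCoeff f 2 = ((0 : ℤ) : ℂ)) (hW : IsFrickeEigen N f (-((1 : ℤ) : ℂ)))
    (hN : N % 8 = 1 ∨ N % 8 = 7) (hv : padicValRat 2 (ratPlusSymbol f 0) = 1) :
    ∀ Lplus Lminus : IwasawaAlgebra 2, IsPollackPair f 2 Lplus Lminus → ¬ PowerSeries.C (2 : ℤ_[2]) ∣ Lminus := by
  obtain ⟨b, hb, hnorm⟩ := norm_ratPlusSymbol_sixteenth_eq_two_of_padicValRat_eq_one hf hQ h2N ha₂ hW hN hv
  have hbodd : Odd b := by rcases hb with rfl | rfl <;> decide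
  have hd : ((16 : ℤ)).natAbs = 2 ^ (2 + 2) := by decide
  obtain ⟨s, hs⟩ := SignedMuAtTwo.exists_ratPlusSymbol_pow_cyclotomicGenerator_eq f hbodd 2 hd
  refine SignedMuAtTwo.flatAtTwo_of_two_le_norm_ratPlusSymbol (n := 2) ⟨1, rfl⟩ (s := s) ?_
  have hcast : ((b : ℚ) / ((16 : ℤ) : ℚ)) = (b : ℚ) / 16 := by push_cast; rfl
  rw [hs, hcast, hnorm]

/-- The same certificate in the SYMBOL currency of the old-class descent (`SignedMuAtTwo.exists_odd_of_plusSymbol_congruence`):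
`[b/4^2]⁺_f = [0]⁺_f + m/2` with `m` ODD (`m = −3·[0]⁺_f/2`, an odd integer since `3[0]⁺_f ∈ ℤ` has `ord₂ = 1`).
[cite: MazurTateTeitelbaum1986Invent, §I.4 (4.2), §I.8 and §I.17] -/
theorem exists_odd_sixteenth_of_padicValRat_eq_one (hf : IsNewform0 f) (hQ : coeffField f = ⊥) (h2N : ¬ 2 ∣ N)
    (ha₂ : cuspCoeff f 2 = ((0 : ℤ) : ℂ)) (hW : IsFrickeEigen N f (-((1 : ℤ) : ℂ)))
    (hN : N % 8 = 1 ∨ N % 8 = 7) (hv : padicValRat 2 (ratPlusSymbol f 0) = 1) :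
    ∃ k : ℕ, 1 ≤ k ∧ ∃ b : ℤ, Odd b ∧ ∃ m : ℤ, Odd m ∧
      ratPlusSymbol f ((b : ℚ) / 4 ^ k) = ratPlusSymbol f 0 + (m : ℚ) / 2 := by
  obtain ⟨b, hb, h0⟩ := LevelModEight.exists_ratPlusSymbol_zero_eq_four_mul hf hQ h2N ha₂ hW hN
  have hbodd : Odd b := by rcases hb with rfl | rfl <;> decide
  have hreal : ∀ n, (cuspCoeff f n).im = 0 := cuspCoeff_im_eq_zero_of_coeffField_eq_bot hQ
  -- `3[0]⁺ = t ∈ ℤ` with `ord₂ t = 1`: `t = 2u`, `u` odd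
  obtain ⟨t, ht⟩ := exists_three_mul_ratPlusSymbol_zero_eq_intCast hf hreal h2N (by rw [ha₂, Int.cast_zero])
  have hs0 : ratPlusSymbol f 0 ≠ 0 := by
    intro h
    rw [h, padicValRat.zero] at hv
    exact zero_ne_one hv
  have ht0 : t ≠ 0 := by
    rintro rfl
    simp only [Int.cast_zero, mul_eq_zero, OfNat.ofNat_ne_zero, false_or] at ht
    exact hs0 ht
  have hvt : padicValRat 2 (t : ℚ) = 1 := by
    rw [← ht, padicValRat.mul (by norm_num) hs0, hv]
    have h3 : padicValRat 2 (3 : ℚ) = 0 := by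
      rw [show (3 : ℚ) = ((3 : ℕ) : ℚ) by norm_num, padicValRat.of_nat]
      norm_num [padicValNat.eq_zero_of_not_dvd]
    rw [h3, zero_add]
  have hvt' : padicValInt 2 t = 1 := by
    have h := padicValRat.of_int (p := 2) (z := t)
    rw [hvt] at h
    exact_mod_cast h.symm
  have h2t : (2 : ℤ) ∣ t := by
    have h := (padicValInt_dvd_iff (p := 2) 1 t).mpr (Or.inr (by rw [hvt']))
    simpa using h
  obtain ⟨u, rfl⟩ := h2t
  have huodd : Odd u := by
    rcases Int.even_or_odd u with hue | huo
    · exfalso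
      obtain ⟨w, rfl⟩ := hue
      have h4 : (2 : ℤ) ^ 2 ∣ 2 * (w + w) := ⟨w, by ring⟩
      rcases (padicValInt_dvd_iff (p := 2) 2 (2 * (w + w))).mp h4 with h0 | hle
      · exact ht0 h0
      · rw [hvt'] at hle
        exact absurd hle (by norm_num)
    · exact huo
  -- `[b/16] = [0]/4 = [0] + m/2` with `m = −3[0]/2 = −u`
  refine ⟨2, by norm_num, b, hbodd, -u, huodd.neg, ?_⟩
  have h16 : ((b : ℚ) / 4 ^ 2) = (b : ℚ) / 16 := by norm_num
  rw [h16]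
  have hs : ratPlusSymbol f 0 = ((2 * u : ℤ) : ℚ) / 3 := by rw [← ht]; ring
  have hx : ratPlusSymbol f ((b : ℚ) / 16) = ratPlusSymbol f 0 / 4 := by rw [h0]; ring
  rw [hx, hs]
  push_cast
  ring

end Symbols

/-! ## §2. The zone bookkeeping in full: `ord₂ [0]⁺_{f_A} = ord₂ #Ш(A) + ord₂ ∏c_ℓ(A)` (PUB) -/

section Zone

variable (A : WeierstrassCurve ℚ) [A.IsElliptic] [A.IsGloballyMinimal]

/-- **`ord₂ (L(A,1)/Ω⁺_{f_A}) = ord₂ #Ш(A) + ord₂ ∏_ℓ c_ℓ(A)`** for a CM curve `A` of analytic rank `0`, good supersingular at `2`,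
and any newform `f` of `A` — granted Burungale–Flach (`hBF`: BSD₂(A)), the entire continuation (`hLrat`), GZK (`hGZK`) and the
`p = 2` period fact (`h2`: the Néron/newform period ratio is a `2`-adic unit); `2 ∤ #A(ℚ)_tors` because `A[2]` is irreducible
(`P2.irr_two_of_goodSS_two`). The lineage's zone lemma `unitZone_of_not_two_dvd_shaOrder_mul_tamagawaProduct` is the case `0 = 0`.
[cite: BurungaleFlach2024, Thm. 1.1] [cite: Miller2011LMS, Def. 1.1] -/
theorem padicValRat_ratPlusSymbol_zero_eq_of_pub
    (hBF : bsdTriple_of_hasCM_of_L_one_ne_zero) (hLrat : hasEntireLFunction_rat)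
    (hGZK : rank_eq_analyticRank_of_analyticRank_le_one)
    (h2 : Literature.NumberTheory.EllipticCurves.realPeriodRat_eq_unit_mul_plusPeriod_two)
    (hcm : A.HasCM) (hr : A.analyticRank = 0) (hss : GoodSS A 2)
    [NeZero (A.conductorNorm ℤ)] {f : CuspForm (Gamma0 (A.conductorNorm ℤ)) 2} (hf : IsNewformOf A f) :
    padicValRat 2 (ratPlusSymbol f 0) = (padicValNat 2 A.shaOrder : ℤ) + padicValNat 2 A.tamagawaProduct := by
  have hL : A.entireLFunction 1 ≠ 0 := (A.analyticRank_eq_zero_iff_holds (hLrat A)).mp hr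
  have hirr : A.HasIrreducibleModPGaloisRep 2 := P2.irr_two_of_goodSS_two A hss
  have hΩpos : 0 < A.realPeriodRat := A.realPeriodRat_pos_holds
  -- the period ratio `ϖ = u⁻¹` of `h2`
  obtain ⟨u, hu1, hu⟩ := h2 A hss.1 hirr f hf
  have hu0 : u ≠ 0 := by
    rintro rfl
    simp at hu1
  have hϖ : (((u⁻¹ : ℚ)) : ℝ) * A.realPeriodRat = plusPeriod f := by
    rw [hu]; push_cast; field_simp
  have hϖ1 : padicValRat 2 (u⁻¹ : ℚ) = 0 := padicValRat_periodRatio_eq_zero_two A h2 hss hf hϖ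
  -- `t = ϖ · [0]⁺_f = L(A,1)/Ω_A`
  set s : ℚ := ratPlusSymbol f 0 with hs_def
  set t : ℚ := u⁻¹ * s with ht_def
  have hLval : A.entireLFunction 1 = (((s : ℝ) * plusPeriod f : ℝ) : ℂ) := hf.entireLFunction_one_eq
  have ht : A.entireLFunction 1 / (A.realPeriodRat : ℂ) = ((t : ℚ) : ℂ) := by
    rw [hLval, ← hϖ, div_eq_iff (Complex.ofReal_ne_zero.mpr hΩpos.ne'), ht_def]
    push_cast
    ring
  have hs0 : s ≠ 0 := by
    intro h0
    apply hL
    rw [hLval, h0]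
    simp
  have ht0 : t ≠ 0 := mul_ne_zero (inv_ne_zero hu0) hs0
  -- BSD₂(A) (Burungale–Flach): `ord₂ #Ш_an = ord₂ #Ш`, `#Ш_an = t·#tors²/∏c_ℓ`
  have hBSD : BSDp A 2 :=
    forall_bsdp_of_bsdTriple A A.tamagawaProduct_pos_holds (hBF A hcm hL) 2 Nat.prime_two
  haveI : Finite A.sha := (hGZK A (by omega)).2
  obtain ⟨q, hq, hv⟩ := missingPPartAt_of_bsdp A 2 hBSD
  have hsha := shaAn_eq_of_analyticRank_eq_zero A hGZK hr ht
  have hqt : q = t * (A.torsionOrder : ℚ) ^ 2 / (A.tamagawaProduct : ℚ) := by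
    have h := hq.symm.trans hsha
    exact_mod_cast h
  rw [hqt, padicValRat_shaAn_witness A 2 hirr ht0] at hv
  have hvt : padicValRat 2 t = (padicValNat 2 A.shaOrder : ℤ) + padicValNat 2 A.tamagawaProduct := by
    linarith
  rw [ht_def, padicValRat.mul (inv_ne_zero hu0) hs0, hϖ1, zero_add] at hvt
  exact hvt

end Zone

/-! ## §3. K2r0P currency: (μ♭)_A AT every rank-`0` CM `A` with `N_A ≡ ±1 (mod 8)` and `ord₂ (#Ш·∏c) = 1`, from PUB -/

section Habitat

variable (A : WeierstrassCurve ℚ) [A.IsElliptic] [A.IsGloballyMinimal]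

/-- **FLAT AT `A` from the printed inputs, at `N_A ≡ ±1 (mod 8)` with `2 ∥ #Ш(A)·∏c_ℓ(A)`.** Granted BY NAME Burungale–Flach
(`hBF`), the entire continuation (`hLrat`), GZK (`hGZK`) and the period unit at `2` (`h2`): for every CM `A/ℚ` (globally
minimal) of analytic rank `0`, good supersingular at `2` with `a₂ = 0`, conductor `≡ ±1 (mod 8)` and
`ord₂ #Ш(A) + ord₂ ∏c_ℓ(A) = 1`, every newform `f` of `A` and every Pollack pair `(L⁺, L⁻)` of `f` at `2`:
`2 ∤ L⁻` (μ(L♭) = 0). Root number `+1` (`L(A,1) ≠ 0`) gives the Fricke sign; §2 gives `ord₂ [0]⁺_f = 1`; §1 concludes.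
[cite: BurungaleFlach2024, Thm. 1.1] [cite: AtkinLehner1970, Thm. 3] [cite: Pollack2003, Prop. 6.18] -/
theorem flatAtTwo_at_of_mod_eight_of_padicValNat_eq_one
    (hBF : bsdTriple_of_hasCM_of_L_one_ne_zero) (hLrat : hasEntireLFunction_rat)
    (hGZK : rank_eq_analyticRank_of_analyticRank_le_one)
    (h2 : Literature.NumberTheory.EllipticCurves.realPeriodRat_eq_unit_mul_plusPeriod_two)
    (hcm : A.HasCM) (hr : A.analyticRank = 0) (hss : GoodSS A 2) (ha : A.frobeniusTrace 2 = 0)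
    (hN : A.conductorNorm ℤ % 8 = 1 ∨ A.conductorNorm ℤ % 8 = 7)
    (hz : padicValNat 2 A.shaOrder + padicValNat 2 A.tamagawaProduct = 1)
    [NeZero (A.conductorNorm ℤ)] {f : CuspForm (Gamma0 (A.conductorNorm ℤ)) 2} (hf : IsNewformOf A f) :
    ∀ Lplus Lminus : IwasawaAlgebra 2, IsPollackPair f 2 Lplus Lminus → ¬ PowerSeries.C (2 : ℤ_[2]) ∣ Lminus := by
  have hL : A.entireLFunction 1 ≠ 0 := (A.analyticRank_eq_zero_iff_holds (hLrat A)).mp hr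
  have hw : A.rootNumber = 1 := WeierstrassCurve.rootNumber_eq_one_of_entireLFunction_one_ne_zero hL
  have hFr : IsFrickeEigen (A.conductorNorm ℤ) f (-((1 : ℤ) : ℂ)) := by
    have h := hf.isFrickeEigen_neg_rootNumber
    rwa [hw] at h
  have hap : cuspCoeff f 2 = ((0 : ℤ) : ℂ) := by
    rw [cuspCoeff_eq_frobeniusTrace_of_isNewformOf_holds hf hss.1, ha]
  have h2N : ¬ 2 ∣ A.conductorNorm ℤ := not_dvd_level_of_isNewformOf hf hss.1
  have hv : padicValRat 2 (ratPlusSymbol f 0) = 1 := by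
    rw [padicValRat_ratPlusSymbol_zero_eq_of_pub A hBF hLrat hGZK h2 hcm hr hss hf]
    exact_mod_cast hz
  exact flatAtTwo_of_mod_eight_of_padicValRat_eq_one hf.1 hf.coeffField_eq_bot h2N hap hFr hN hv

/-- **(μ♭)_A AT `A`, in the registered stub's currency** (`∃ n, IsUnit (coeff n (kobayashiL 1 L⁺ L⁻))`, Kobayashi's `L_p^+` = the
tree's `L⁻`): for every CM `A/ℚ` of analytic rank `0`, good supersingular at `2` with `a₂ = 0`, `N_A ≡ ±1 (mod 8)` and
`ord₂ (#Ш(A)·∏c_ℓ(A)) = 1`, granted `hBF hLrat hGZK h2` by name. These `A` are OFF the unit zone (`2 ∣ #Ш·∏c`), so this is a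
case of the off-zone research binder `stub_analyticMuFlatNonUnitCMTwo` of line `rankzero` settled from print.
[cite: BurungaleFlach2024, Thm. 1.1] [cite: Pollack2003, Prop. 6.18] [cite: Kobayashi2003, Thm. 1.2] -/
theorem analyticMuFlat_at_of_mod_eight_of_padicValNat_eq_one
    (hBF : bsdTriple_of_hasCM_of_L_one_ne_zero) (hLrat : hasEntireLFunction_rat)
    (hGZK : rank_eq_analyticRank_of_analyticRank_le_one)
    (h2 : Literature.NumberTheory.EllipticCurves.realPeriodRat_eq_unit_mul_plusPeriod_two)
    (hcm : A.HasCM) (hr : A.analyticRank = 0) (hss : GoodSS A 2) (ha : A.frobeniusTrace 2 = 0)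
    (hN : A.conductorNorm ℤ % 8 = 1 ∨ A.conductorNorm ℤ % 8 = 7)
    (hz : padicValNat 2 A.shaOrder + padicValNat 2 A.tamagawaProduct = 1) :
    ∀ [NeZero (A.conductorNorm ℤ)] (f : CuspForm (Gamma0 (A.conductorNorm ℤ)) 2), IsNewformOf A f →
      ∀ (Lplus Lminus : IwasawaAlgebra 2), IsPollackPair f 2 Lplus Lminus →
        ∃ n : ℕ, IsUnit (PowerSeries.coeff n (kobayashiL 1 Lplus Lminus)) := by
  intro _ f hf Lplus Lminus hPP
  rw [kobayashiL_one]
  exact exists_isUnit_coeff_of_not_C_two_dvd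
    (flatAtTwo_at_of_mod_eight_of_padicValNat_eq_one A hBF hLrat hGZK h2 hcm hr hss ha hN hz hf Lplus Lminus hPP)

omit [A.IsElliptic] [A.IsGloballyMinimal] in
/-- **`ord₂ (#Ш·∏c) = 1` in divisibility words**: `2 ∣ #Ш(A)·∏c_ℓ(A)` and `4 ∤ #Ш(A)·∏c_ℓ(A)` give
`ord₂ #Ш(A) + ord₂ ∏c_ℓ(A) = 1` (both factors are positive). [folklore] -/
theorem padicValNat_add_eq_one_of_two_dvd_of_not_four_dvd
    (h2 : 2 ∣ A.shaOrder * A.tamagawaProduct) (h4 : ¬ 4 ∣ A.shaOrder * A.tamagawaProduct) :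
    padicValNat 2 A.shaOrder + padicValNat 2 A.tamagawaProduct = 1 := by
  haveI : Fact (Nat.Prime 2) := ⟨Nat.prime_two⟩
  have hprod0 : A.shaOrder * A.tamagawaProduct ≠ 0 := fun h ↦ h4 (h ▸ dvd_zero 4)
  have hsha0 : A.shaOrder ≠ 0 := (mul_ne_zero_iff.mp hprod0).1
  have htam0 : A.tamagawaProduct ≠ 0 := (mul_ne_zero_iff.mp hprod0).2
  rw [← padicValNat.mul hsha0 htam0]
  have h1 : 1 ≤ padicValNat 2 (A.shaOrder * A.tamagawaProduct) :=
    (padicValNat_dvd_iff_le hprod0).mp (by simpa using h2)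
  have h2' : ¬ 2 ≤ padicValNat 2 (A.shaOrder * A.tamagawaProduct) := fun hle ↦
    h4 ((padicValNat_dvd_iff_le hprod0).mpr (by simpa using hle))
  omega

end Habitat

end FlatLevelSixteen

end Summit.BirchSwinnertonDyer.BirchSwinnertonDyer.Theorems

end
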